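import Summits.QuantumAdvantage.QuantumAdvantage.Theorems.CubicForrelationNearExactIsExactFourModSixResidual
import Summits.QuantumAdvantage.QuantumAdvantage.Theorems.CubicForrelationNearExactIsExactSixteenSplitBudget
import Summits.QuantumAdvantage.QuantumAdvantage.Theorems.CubicForrelationNearExactIsExactZeroModSixSecondTypeO

/-!
# Crux `CubicForrelation.NearExactIsExact` (stmt-QuantumAdvantage-14043) — `n = 6r+4`, TWO-SIDED budget in the SPLIT case at the second
  boundary: the three configurations (sA), (sB), (sC) (`r ≥ 3`)

Certificate seat `b2b-cforr-cert` (gen 8).  HONEST FRAMING: a structural lemma uniform in `r` about cubic Boolean pairs on `6r+4` bits — the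
first step of the two-sided exclusion of the second boundary value `Φ = 1 − 2^{−(2r+1)}` when the Ax-level parity is a non-constant affine
function (the tree's `n = 16` file `…SixteenSplitBudget.lean` in general `r`); NOT summit progress.

With `W_g = 2^{2r+2}u`, `s = (−1)^f`, the budget is `Σ_x (u − 2^r s)² = 2^{8r+5}(1 − Φ) ≤ 2^{6r+4} = N` (`fms_budget`).  For `r ≥ 3` the shift
`2^r s` is `≡ 0 (mod 8)`, so ONE pointwise inequality (`f2_pt2`) holds for every integer `v`, sign `s` and `8 ∣ c`:
`(v − cs)² ≥ [v odd] + 4·[v ≡ 2 (4)] + 16·[v ≡ 4 (8)] + 8·[v ≡ ±3 (8)]`,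
with the digit sets `O = {d₀}`, `A = {¬d₀ ∧ d₁}`, `B' = {¬d₀ ∧ ¬d₁ ∧ d₂}`, `C' = {d₀ ∧ (d₁ ≠ d₂)}` (at `n = 16`, `r = 2`, the sets `B, C` were
`{¬d₀ ∧ ¬d₁ ∧ ¬d₂}`, `{d₀ ∧ (d₁ = d₂)}`).  In the split case `#O = N/2` and Reed–Muller (`A` degree `≤ 3`, `B'` degree `≤ 5`, `C'` degree `≤ 4`;
residual excluded by `f2_residual_false`) give `#O + 4#A + 16#B' + 8#C' ≥ N`.  Hence (`f2_split_trichotomy`) `Φ ≥ 1 − 2^{−(2r+1)}` forces: the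
budget identity `2^{8r+5}(1−Φ) = N`, POINTWISE equality in `f2_pt2`, and exactly one of (sA) `#A = N/8, B' = C' = ∅`; (sB) `A = ∅, #B' = N/32,
C' = ∅`; (sC) `A = B' = ∅, #C' = N/16`.

References: J. Ax (1964) / R. J. McEliece (1972); MacWilliams–Sloane (1977) Ch. 13–15.  Everything below is proved from Mathlib and the
tree; axioms are the standard three.
-/

set_option linter.dupNamespace false -- D-0017: single-problem summit ⇒ `QuantumAdvantage.QuantumAdvantage` by design

noncomputable section

namespace Summit.QuantumAdvantage.QuantumAdvantage.Theorems.CubicForrelation.NearExactIsExact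

open Finset
open Literature.Computability.QuantumComplexity
open Literature.Computability.QuantumComplexity.DerivativeWalsh (W)

/-! ### The two-sided pointwise inequality (`8 ∣ c`) -/

/-- Core form: for every integer `w`, `[w odd] + 4·[w ≡ 2 (4)] + 16·[w ≡ 4 (8)] + 8·[w odd ∧ bit₁ ≠ bit₂] ≤ w²`. [folklore] -/
theorem f2_pt2_core (w : ℤ) :
    (if Odd w then 1 else 0) + 4 * (if ¬ Odd w ∧ Odd (w / 2) then 1 else 0)
      + 16 * (if ¬ Odd w ∧ ¬ Odd (w / 2) ∧ Odd (w / 2 / 2) then 1 else 0)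
      + 8 * (if Odd w ∧ ¬ (Odd (w / 2) ↔ Odd (w / 2 / 2)) then 1 else 0) ≤ w ^ 2 := by
  rcases le_or_gt 5 |w| with h5 | h5
  · have hbig : (25 : ℤ) ≤ w ^ 2 := by
      have h := tp_sq_ge (k := 5) (t := w) (by norm_num) (by
        rcases le_or_gt 0 w with hw0 | hw0
        · rw [abs_of_nonneg hw0] at h5; exact Or.inr h5
        · rw [abs_of_neg hw0] at h5; exact Or.inl (by linarith))
      linarith
    have hconst : (if Odd w then 1 else 0) + 4 * (if ¬ Odd w ∧ Odd (w / 2) then 1 else 0)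
        + 16 * (if ¬ Odd w ∧ ¬ Odd (w / 2) ∧ Odd (w / 2 / 2) then 1 else 0)
        + 8 * (if Odd w ∧ ¬ (Odd (w / 2) ↔ Odd (w / 2 / 2)) then 1 else 0) ≤ (25 : ℤ) := by
      split_ifs <;> (try simp only [Int.odd_iff] at *) <;> omega
    linarith
  · have h1 : -4 ≤ w := by have := (abs_lt.1 h5).1; omega
    have h2 : w ≤ 4 := by have := (abs_lt.1 h5).2; omega
    interval_cases w <;> norm_num [Int.odd_iff]

/-- **The two-sided pointwise inequality (second boundary, `8 ∣ c`).** For every integer `v`, `s = ±1` and `8 ∣ c`: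
`[v odd] + 4·[¬d₀ ∧ d₁] + 16·[¬d₀ ∧ ¬d₁ ∧ d₂] + 8·[d₀ ∧ (d₁ ≠ d₂)] ≤ (v − cs)²` in the Euclidean binary digits of `v`. [this work] -/
theorem f2_pt2 (v s c : ℤ) (hs : s = 1 ∨ s = -1) (hc : (8 : ℤ) ∣ c) :
    (if Odd v then 1 else 0) + 4 * (if ¬ Odd v ∧ Odd (v / 2) then 1 else 0)
      + 16 * (if ¬ Odd v ∧ ¬ Odd (v / 2) ∧ Odd (v / 2 / 2) then 1 else 0)
      + 8 * (if Odd v ∧ ¬ (Odd (v / 2) ↔ Odd (v / 2 / 2)) then 1 else 0) ≤ (v - c * s) ^ 2 := by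
  obtain ⟨t, ht⟩ := hc
  subst ht
  have key := f2_pt2_core (v - 8 * t * s)
  have e0 : (Odd (v - 8 * t * s) ↔ Odd v) := by
    rw [Int.odd_iff, Int.odd_iff]; rcases hs with rfl | rfl <;> omega
  have e1 : (Odd ((v - 8 * t * s) / 2) ↔ Odd (v / 2)) := by
    rw [Int.odd_iff, Int.odd_iff]; rcases hs with rfl | rfl <;> omega
  have e2 : (Odd ((v - 8 * t * s) / 2 / 2) ↔ Odd (v / 2 / 2)) := by
    rw [Int.odd_iff, Int.odd_iff]; rcases hs with rfl | rfl <;> omega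
  simp only [e0, e1, e2] at key
  exact key

section Split

variable (r : ℕ) (f g : (Fin ((3 * r + 2) + (3 * r + 2)) → Bool) → Bool) (u : (Fin ((3 * r + 2) + (3 * r + 2)) → Bool) → ℤ)

/-- Summing `f2_pt2` (`c = 2^{k+3}`): `#O + 4#A + 16#B' + 8#C' ≤ Σ_x (u − 2^{k+3}s)²`. [this work] -/
theorem f2_sum_pt2 (k : ℕ) :
    (#(univ.filter fun x : Fin ((3 * r + 2) + (3 * r + 2)) → Bool => Odd (u x)) : ℤ)
      + 4 * (#(univ.filter fun x : Fin ((3 * r + 2) + (3 * r + 2)) → Bool => ¬ Odd (u x) ∧ Odd (u x / 2)) : ℤ)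
      + 16 * (#(univ.filter fun x : Fin ((3 * r + 2) + (3 * r + 2)) → Bool =>
          ¬ Odd (u x) ∧ ¬ Odd (u x / 2) ∧ Odd (u x / 2 / 2)) : ℤ)
      + 8 * (#(univ.filter fun x : Fin ((3 * r + 2) + (3 * r + 2)) → Bool =>
          Odd (u x) ∧ ¬ (Odd (u x / 2) ↔ Odd (u x / 2 / 2))) : ℤ)
      ≤ ∑ x, (u x - 2 ^ (k + 3) * sZ (f x)) ^ 2 := by
  have h8 : (8 : ℤ) ∣ 2 ^ (k + 3) := ⟨2 ^ k, by ring⟩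
  have h := sum_le_sum fun x (_ : x ∈ (univ : Finset (Fin ((3 * r + 2) + (3 * r + 2)) → Bool))) =>
    f2_pt2 (u x) (sZ (f x)) (2 ^ (k + 3)) (tp_sZ_cases (f x)) h8
  simp only [sum_add_distrib, ← mul_sum, sum_boole] at h
  linarith

/-- **The Reed–Muller counts in the split case (second boundary).** If the Ax-level parity takes both values, then `A ≠ ∅ ⇒ #A ≥ N/8`,
`A = ∅ ∧ B' ≠ ∅ ⇒ #B' ≥ N/32`, `A = B' = ∅ ∧ C' ≠ ∅ ⇒ #C' ≥ N/16`, and `A = B' = C' = ∅` is impossible (`f2_residual_false`). [this work] -/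
theorem f2_rm_counts (hr : 1 ≤ r) (hg : IsDegLeFun 3 g) (hu : ∀ x, W (fun y => signOf (g y)) x = (2 : ℝ) ^ (2 * r + 2) * (u x : ℝ))
    (hodd : ∃ x, Odd (u x)) (heven : ∃ x, ¬ Odd (u x)) :
    ((∃ x, ¬ Odd (u x) ∧ Odd (u x / 2)) →
      2 ^ ((3 * r + 2) + (3 * r + 2)) ≤ 2 ^ 3 * #(univ.filter fun x : Fin ((3 * r + 2) + (3 * r + 2)) → Bool => ¬ Odd (u x) ∧ Odd (u x / 2))) ∧
    ((∀ x, ¬ Odd (u x) → ¬ Odd (u x / 2)) → (∃ x, ¬ Odd (u x) ∧ Odd (u x / 2 / 2)) →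
      2 ^ ((3 * r + 2) + (3 * r + 2)) ≤ 2 ^ 5 * #(univ.filter fun x : Fin ((3 * r + 2) + (3 * r + 2)) → Bool =>
        ¬ Odd (u x) ∧ ¬ Odd (u x / 2) ∧ Odd (u x / 2 / 2))) ∧
    ((∀ x, ¬ Odd (u x) → ¬ Odd (u x / 2) ∧ ¬ Odd (u x / 2 / 2)) → (∃ x, Odd (u x) ∧ ¬ (Odd (u x / 2) ↔ Odd (u x / 2 / 2))) →
      2 ^ ((3 * r + 2) + (3 * r + 2)) ≤ 2 ^ 4 * #(univ.filter fun x : Fin ((3 * r + 2) + (3 * r + 2)) → Bool =>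
        Odd (u x) ∧ ¬ (Odd (u x / 2) ↔ Odd (u x / 2 / 2)))) ∧
    ((∀ x, ¬ Odd (u x) → ¬ Odd (u x / 2) ∧ ¬ Odd (u x / 2 / 2)) →
      (∀ x, Odd (u x) → (Odd (u x / 2) ↔ Odd (u x / 2 / 2))) → False) := by
  have hd0 : IsDegLeFun 1 (fun x => decide (Odd (u x))) := f2_digitZero r g u hg hu
  have hd1 : IsDegLeFun 2 (fun x => decide (Odd (u x / 2))) := f2_digitOne r g u hg hu
  have hd2 : IsDegLeFun 4 (fun x => decide (Odd (u x / 2 / 2))) := f2_digitTwo r g u hg hu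
  refine ⟨fun hxA => ?_, fun hA hxB => ?_, fun hAB hxC => ?_, fun hAB hC => ?_⟩
  · have hdeg : IsDegLeFun 3 (fun x => (decide (Odd (u x)) ^^ true) && decide (Odd (u x / 2))) :=
      bb_deg_and (tb_isDegLeFun_xor_const hd0 true) hd1 (by norm_num)
    have hset : (univ.filter fun x : Fin ((3 * r + 2) + (3 * r + 2)) → Bool =>
        ((decide (Odd (u x)) ^^ true) && decide (Odd (u x / 2))) = true) =
        univ.filter fun x : Fin ((3 * r + 2) + (3 * r + 2)) → Bool => ¬ Odd (u x) ∧ Odd (u x / 2) := filter_congr fun x _ => by simp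
    obtain ⟨x₀, hx₀, hx₀'⟩ := hxA
    have hrm := bb_rmWeight_holds ((3 * r + 2) + (3 * r + 2)) 3 _ hdeg ⟨x₀, by simp [hx₀, hx₀']⟩
    rw [hset] at hrm
    exact hrm
  · have hdeg : IsDegLeFun 5 (fun x => (decide (Odd (u x)) ^^ true) && decide (Odd (u x / 2 / 2))) :=
      bb_deg_and (tb_isDegLeFun_xor_const hd0 true) hd2 (by norm_num)
    have hset : (univ.filter fun x : Fin ((3 * r + 2) + (3 * r + 2)) → Bool =>
        ((decide (Odd (u x)) ^^ true) && decide (Odd (u x / 2 / 2))) = true) =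
        univ.filter fun x : Fin ((3 * r + 2) + (3 * r + 2)) → Bool => ¬ Odd (u x) ∧ ¬ Odd (u x / 2) ∧ Odd (u x / 2 / 2) := by
      apply filter_congr
      intro x _
      simp only [Bool.xor_true, Bool.and_eq_true, Bool.not_eq_true', decide_eq_false_iff_not, decide_eq_true_eq]
      exact ⟨fun h => ⟨h.1, hA x h.1, h.2⟩, fun h => ⟨h.1, h.2.2⟩⟩
    obtain ⟨x₀, hx₀, hx₀'⟩ := hxB
    have hrm := bb_rmWeight_holds ((3 * r + 2) + (3 * r + 2)) 5 _ hdeg ⟨x₀, by simp [hx₀, hx₀']⟩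
    rw [hset] at hrm
    exact hrm
  · have hdeg : IsDegLeFun 4 (fun x => decide (Odd (u x / 2)) ^^ decide (Odd (u x / 2 / 2))) :=
      bb_isDegLeFun_bxor (hd1.mono (by norm_num)) hd2
    have hset : (univ.filter fun x : Fin ((3 * r + 2) + (3 * r + 2)) → Bool =>
        (decide (Odd (u x / 2)) ^^ decide (Odd (u x / 2 / 2))) = true) =
        univ.filter fun x : Fin ((3 * r + 2) + (3 * r + 2)) → Bool => Odd (u x) ∧ ¬ (Odd (u x / 2) ↔ Odd (u x / 2 / 2)) := by
      apply filter_congr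
      intro x _
      by_cases h0 : Odd (u x)
      · by_cases h1 : Odd (u x / 2) <;> by_cases h2 : Odd (u x / 2 / 2) <;> simp [h0, h1, h2]
      · have h12 := hAB x h0
        simp [h0, h12.1, h12.2]
    obtain ⟨x₀, hx₀, hx₀'⟩ := hxC
    have hrm := bb_rmWeight_holds ((3 * r + 2) + (3 * r + 2)) 4 _ hdeg ⟨x₀, z2_xor_decide_of_not_iff hx₀'⟩
    rw [hset] at hrm
    exact hrm
  · exact f2_residual_false r g u hr hg hu hodd heven hAB hC

/-- **The split trichotomy at the second boundary (`r ≥ 3`).**  For cubic `f, g : 𝔽₂^{(3r+2)+(3r+2)} → 𝔽₂` with `W_g = 2^{2r+2}u`, the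
Ax-level parity `[u odd]` non-constant and `Φ(f,g) ≥ 1 − (1/2)^{2r+1}`: the two-sided budget is spent EXACTLY — `2^{8r+5}(1−Φ) = N`, the
pointwise inequality `f2_pt2` is an equality at every point — and exactly one of (sA) `#A = N/8, B' = C' = ∅`, (sB) `A = ∅, #B' = N/32,
C' = ∅`, (sC) `A = B' = ∅, #C' = N/16` holds (`N = 2^{6r+4}`). [this work] -/
theorem f2_split_trichotomy (hr : 3 ≤ r) (hg : IsDegLeFun 3 g)
    (hu : ∀ x, W (fun y => signOf (g y)) x = (2 : ℝ) ^ (2 * r + 2) * (u x : ℝ))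
    (hodd : ∃ x, Odd (u x)) (heven : ∃ x, ¬ Odd (u x)) (hΦ : 1 - (1 / 2 : ℝ) ^ (2 * r + 1) ≤ forrelation f g) :
    (2 : ℝ) ^ (8 * r + 5) * (1 - forrelation f g) = 2 ^ (6 * r + 4) ∧
    (∀ x, (u x - 2 ^ r * sZ (f x)) ^ 2 = (if Odd (u x) then 1 else 0) + 4 * (if ¬ Odd (u x) ∧ Odd (u x / 2) then 1 else 0)
      + 16 * (if ¬ Odd (u x) ∧ ¬ Odd (u x / 2) ∧ Odd (u x / 2 / 2) then 1 else 0)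
      + 8 * (if Odd (u x) ∧ ¬ (Odd (u x / 2) ↔ Odd (u x / 2 / 2)) then 1 else 0)) ∧
    ((#(univ.filter fun x : Fin ((3 * r + 2) + (3 * r + 2)) → Bool => ¬ Odd (u x) ∧ Odd (u x / 2)) = 2 ^ (6 * r + 1) ∧
        #(univ.filter fun x : Fin ((3 * r + 2) + (3 * r + 2)) → Bool => ¬ Odd (u x) ∧ ¬ Odd (u x / 2) ∧ Odd (u x / 2 / 2)) = 0 ∧
        #(univ.filter fun x : Fin ((3 * r + 2) + (3 * r + 2)) → Bool => Odd (u x) ∧ ¬ (Odd (u x / 2) ↔ Odd (u x / 2 / 2))) = 0) ∨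
      (#(univ.filter fun x : Fin ((3 * r + 2) + (3 * r + 2)) → Bool => ¬ Odd (u x) ∧ Odd (u x / 2)) = 0 ∧
        #(univ.filter fun x : Fin ((3 * r + 2) + (3 * r + 2)) → Bool =>
          ¬ Odd (u x) ∧ ¬ Odd (u x / 2) ∧ Odd (u x / 2 / 2)) = 2 ^ (6 * r - 1) ∧
        #(univ.filter fun x : Fin ((3 * r + 2) + (3 * r + 2)) → Bool => Odd (u x) ∧ ¬ (Odd (u x / 2) ↔ Odd (u x / 2 / 2))) = 0) ∨
      (#(univ.filter fun x : Fin ((3 * r + 2) + (3 * r + 2)) → Bool => ¬ Odd (u x) ∧ Odd (u x / 2)) = 0 ∧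
        #(univ.filter fun x : Fin ((3 * r + 2) + (3 * r + 2)) → Bool => ¬ Odd (u x) ∧ ¬ Odd (u x / 2) ∧ Odd (u x / 2 / 2)) = 0 ∧
        #(univ.filter fun x : Fin ((3 * r + 2) + (3 * r + 2)) → Bool =>
          Odd (u x) ∧ ¬ (Odd (u x / 2) ↔ Odd (u x / 2 / 2))) = 2 ^ (6 * r))) := by
  classical
  obtain ⟨k, rfl⟩ : ∃ k, r = k + 3 := ⟨r - 3, by omega⟩
  set O := univ.filter fun x : Fin ((3 * (k + 3) + 2) + (3 * (k + 3) + 2)) → Bool => Odd (u x) with hO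
  set A := univ.filter fun x : Fin ((3 * (k + 3) + 2) + (3 * (k + 3) + 2)) → Bool => ¬ Odd (u x) ∧ Odd (u x / 2) with hA
  set B := univ.filter fun x : Fin ((3 * (k + 3) + 2) + (3 * (k + 3) + 2)) → Bool =>
    ¬ Odd (u x) ∧ ¬ Odd (u x / 2) ∧ Odd (u x / 2 / 2) with hB
  set C := univ.filter fun x : Fin ((3 * (k + 3) + 2) + (3 * (k + 3) + 2)) → Bool =>
    Odd (u x) ∧ ¬ (Odd (u x / 2) ↔ Odd (u x / 2 / 2)) with hC
  have hOcard : #O = 2 ^ (6 * (k + 3) + 3) := f2_card_odd_of_split (k + 3) g u hg hu hodd heven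
  obtain ⟨cA, cB, cC, cR⟩ := f2_rm_counts (k + 3) g u (by omega) hg hu hodd heven
  -- budget `T ≤ N`
  have hbud := fms_budget (k + 3) f g u hu
  have hpow : (2 : ℝ) ^ (8 * (k + 3) + 5) * (1 / 2) ^ (2 * (k + 3) + 1) = 2 ^ (6 * k + 22) := by
    rw [one_div_pow]; field_simp; ring
  have hT : (∑ x, (u x - 2 ^ (k + 3) * sZ (f x)) ^ 2 : ℤ) ≤ 2 ^ (6 * k + 22) := by
    have h1 : 1 - forrelation f g ≤ (1 / 2 : ℝ) ^ (2 * (k + 3) + 1) := by linarith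
    have h' : ((∑ x, (u x - 2 ^ (k + 3) * sZ (f x)) ^ 2 : ℤ) : ℝ) ≤ (2 : ℝ) ^ (6 * k + 22) := by
      rw [hbud, ← hpow]
      exact mul_le_mul_of_nonneg_left h1 (by positivity)
    exact_mod_cast h'
  have hsum := f2_sum_pt2 (k + 3) f u k
  have hA0 : (0 : ℤ) ≤ #A := Nat.cast_nonneg _
  have hB0 : (0 : ℤ) ≤ #B := Nat.cast_nonneg _
  have hC0 : (0 : ℤ) ≤ #C := Nat.cast_nonneg _
  have hN2 : (2 : ℕ) ^ ((3 * (k + 3) + 2) + (3 * (k + 3) + 2)) = 2 ^ (6 * k + 22) := by ring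
  have hO' : (#O : ℤ) = 2 ^ (6 * k + 21) := by rw [hOcard]; push_cast; ring
  have hcases : ((#A : ℤ) = 2 ^ (6 * k + 19) ∧ (#B : ℤ) = 0 ∧ (#C : ℤ) = 0) ∨ ((#A : ℤ) = 0 ∧ (#B : ℤ) = 2 ^ (6 * k + 17) ∧ (#C : ℤ) = 0) ∨
      ((#A : ℤ) = 0 ∧ (#B : ℤ) = 0 ∧ (#C : ℤ) = 2 ^ (6 * k + 18)) := by
    have htot : (#O : ℤ) + 4 * #A + 16 * #B + 8 * #C ≤ 2 ^ (6 * k + 22) := le_trans hsum hT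
    rw [hO'] at htot
    have e22 : (2 : ℤ) ^ (6 * k + 22) = 2 * 2 ^ (6 * k + 21) := by ring
    have e21a : (2 : ℤ) ^ (6 * k + 21) = 4 * 2 ^ (6 * k + 19) := by ring
    have e21b : (2 : ℤ) ^ (6 * k + 21) = 16 * 2 ^ (6 * k + 17) := by ring
    have e21c : (2 : ℤ) ^ (6 * k + 21) = 8 * 2 ^ (6 * k + 18) := by ring
    by_cases hxA : ∃ x, ¬ Odd (u x) ∧ Odd (u x / 2)
    · have h13 : (2 : ℤ) ^ (6 * k + 19) ≤ #A := by
        have h := cA hxA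
        rw [hN2, show (2 : ℕ) ^ (6 * k + 22) = 2 ^ 3 * 2 ^ (6 * k + 19) by ring] at h
        exact_mod_cast Nat.le_of_mul_le_mul_left h (by positivity)
      left; refine ⟨by linarith, by linarith, by linarith⟩
    · push Not at hxA
      have hAe : (#A : ℤ) = 0 := by
        have : A = ∅ := filter_eq_empty_iff.2 fun x _ h => hxA x h.1 h.2
        rw [this]; rfl
      by_cases hxB : ∃ x, ¬ Odd (u x) ∧ Odd (u x / 2 / 2)
      · have h11 : (2 : ℤ) ^ (6 * k + 17) ≤ #B := by
          have h := cB hxA hxB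
          rw [hN2, show (2 : ℕ) ^ (6 * k + 22) = 2 ^ 5 * 2 ^ (6 * k + 17) by ring] at h
          exact_mod_cast Nat.le_of_mul_le_mul_left h (by positivity)
        right; left; refine ⟨hAe, by linarith, by linarith⟩
      · push Not at hxB
        have hBe : (#B : ℤ) = 0 := by
          have : B = ∅ := filter_eq_empty_iff.2 fun x _ h => hxB x h.1 h.2.2
          rw [this]; rfl
        have hH : ∀ x, ¬ Odd (u x) → ¬ Odd (u x / 2) ∧ ¬ Odd (u x / 2 / 2) := fun x h => ⟨hxA x h, hxB x h⟩
        by_cases hxC : ∃ x, Odd (u x) ∧ ¬ (Odd (u x / 2) ↔ Odd (u x / 2 / 2))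
        · have h12 : (2 : ℤ) ^ (6 * k + 18) ≤ #C := by
            have h := cC hH hxC
            rw [hN2, show (2 : ℕ) ^ (6 * k + 22) = 2 ^ 4 * 2 ^ (6 * k + 18) by ring] at h
            exact_mod_cast Nat.le_of_mul_le_mul_left h (by positivity)
          right; right; refine ⟨hAe, hBe, by linarith⟩
        · push Not at hxC
          exact (cR hH fun x hx => by have := hxC x hx; tauto).elim
  have htotN : (2 : ℤ) ^ (6 * k + 22) ≤ (#O : ℤ) + 4 * #A + 16 * #B + 8 * #C := by
    rw [hO']
    rcases hcases with ⟨h1, h2, h3⟩ | ⟨h1, h2, h3⟩ | ⟨h1, h2, h3⟩ <;> rw [h1, h2, h3] <;> ring_nf <;> linarith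
  -- hence everything is tight
  have hTeq : (∑ x, (u x - 2 ^ (k + 3) * sZ (f x)) ^ 2 : ℤ) = 2 ^ (6 * k + 22) := le_antisymm hT (le_trans htotN hsum)
  have hΦeq : (2 : ℝ) ^ (8 * (k + 3) + 5) * (1 - forrelation f g) = 2 ^ (6 * (k + 3) + 4) := by
    have h : ((∑ x, (u x - 2 ^ (k + 3) * sZ (f x)) ^ 2 : ℤ) : ℝ) = 2 ^ (6 * k + 22) := by exact_mod_cast hTeq
    rw [hbud] at h
    rw [h]; ring
  have h8 : (8 : ℤ) ∣ 2 ^ (k + 3) := ⟨2 ^ k, by ring⟩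
  have hnonneg : ∀ x, 0 ≤ (u x - 2 ^ (k + 3) * sZ (f x)) ^ 2 - ((if Odd (u x) then 1 else 0)
      + 4 * (if ¬ Odd (u x) ∧ Odd (u x / 2) then 1 else 0)
      + 16 * (if ¬ Odd (u x) ∧ ¬ Odd (u x / 2) ∧ Odd (u x / 2 / 2) then 1 else 0)
      + 8 * (if Odd (u x) ∧ ¬ (Odd (u x / 2) ↔ Odd (u x / 2 / 2)) then 1 else 0) : ℤ) :=
    fun x => by have := f2_pt2 (u x) (sZ (f x)) (2 ^ (k + 3)) (tp_sZ_cases (f x)) h8; linarith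
  have hsum0 : ∑ x, ((u x - 2 ^ (k + 3) * sZ (f x)) ^ 2 - ((if Odd (u x) then 1 else 0)
      + 4 * (if ¬ Odd (u x) ∧ Odd (u x / 2) then 1 else 0)
      + 16 * (if ¬ Odd (u x) ∧ ¬ Odd (u x / 2) ∧ Odd (u x / 2 / 2) then 1 else 0)
      + 8 * (if Odd (u x) ∧ ¬ (Odd (u x / 2) ↔ Odd (u x / 2 / 2)) then 1 else 0) : ℤ)) = 0 := by
    refine le_antisymm ?_ (sum_nonneg fun x _ => hnonneg x)
    have hsplit : ∑ x, ((u x - 2 ^ (k + 3) * sZ (f x)) ^ 2 - ((if Odd (u x) then 1 else 0)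
        + 4 * (if ¬ Odd (u x) ∧ Odd (u x / 2) then 1 else 0)
        + 16 * (if ¬ Odd (u x) ∧ ¬ Odd (u x / 2) ∧ Odd (u x / 2 / 2) then 1 else 0)
        + 8 * (if Odd (u x) ∧ ¬ (Odd (u x / 2) ↔ Odd (u x / 2 / 2)) then 1 else 0) : ℤ)) =
        (∑ x, (u x - 2 ^ (k + 3) * sZ (f x)) ^ 2 : ℤ) - ((#O : ℤ) + 4 * #A + 16 * #B + 8 * #C) := by
      simp only [sum_sub_distrib, sum_add_distrib, ← mul_sum, sum_boole, hO, hA, hB, hC]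
    rw [hsplit, hTeq]
    linarith
  have hpt : ∀ x, (u x - 2 ^ (k + 3) * sZ (f x)) ^ 2 = (if Odd (u x) then 1 else 0)
      + 4 * (if ¬ Odd (u x) ∧ Odd (u x / 2) then 1 else 0)
      + 16 * (if ¬ Odd (u x) ∧ ¬ Odd (u x / 2) ∧ Odd (u x / 2 / 2) then 1 else 0)
      + 8 * (if Odd (u x) ∧ ¬ (Odd (u x / 2) ↔ Odd (u x / 2 / 2)) then 1 else 0) := by
    intro x
    have := (sum_eq_zero_iff_of_nonneg fun y _ => hnonneg y).1 hsum0 x (mem_univ x)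
    linarith
  refine ⟨hΦeq, hpt, ?_⟩
  have e1 : 6 * (k + 3) + 1 = 6 * k + 19 := by ring
  have e2 : 6 * (k + 3) - 1 = 6 * k + 17 := by omega
  have e3 : 6 * (k + 3) = 6 * k + 18 := by ring
  rw [e1, e2, e3]
  rcases hcases with ⟨h1, h2, h3⟩ | ⟨h1, h2, h3⟩ | ⟨h1, h2, h3⟩
  · left; exact ⟨by exact_mod_cast h1, by exact_mod_cast h2, by exact_mod_cast h3⟩
  · right; left; exact ⟨by exact_mod_cast h1, by exact_mod_cast h2, by exact_mod_cast h3⟩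
  · right; right; exact ⟨by exact_mod_cast h1, by exact_mod_cast h2, by exact_mod_cast h3⟩

end Split

end Summit.QuantumAdvantage.QuantumAdvantage.Theorems.CubicForrelation.NearExactIsExact

end
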